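import Summits.CriticalPhenomena.SAWScalingLimit.Theorems.SAWDevelopingMapObservableToSLEShortChordLocalityHelpers
import Summits.CriticalPhenomena.SAWScalingLimit.Theorems.MassRatio.Negative.Walks
import HarnessLib

/-!
# Domain monotonicity of the `σ = 0` masses (crux `BoundaryClosureR`, stmt-CriticalPhenomena-14004,
# line `polygon-parity-squeeze`, registered stub `stub_arrivalMonotone`)

Enlarging the vertex set of a hexagonal-lattice domain can only add self-avoiding walks between two
given mid-edges, and at spin `σ = 0` with fugacity `x ≥ 0` every walk carries the non-negative weight
`x^{ℓ(γ)}`; hence `‖F_{Λ, a, x, 0}(z)‖ = Σ_{γ ⊂ Λ : a → z} x^{ℓ(γ)}` is monotone in `Λ`.  This is the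
lattice half of the squeeze (B) of the line: the gate masses of an admissible family are pinched
between those of an inner exact polygon and themselves.  The statement is the registered stub
`stub_arrivalMonotone : ArrivalMonotone` of `Cruxes/BoundaryClosureR/Lines/polygon_parity_squeeze.lean`,
UNFOLDED verbatim; the proof is the restriction injection `sum_verts_le_of_subset` (landed) after
`MassRatio.Negative.norm_Z_eq_sum` (landed).
-/

noncomputable section

open Literature.Probability.LatticeModels Literature.Probability.RandomPlanarGeometry
open Literature.Probability.RandomPlanarGeometry.SAW
open Summit.CriticalPhenomena.SAWScalingLimit.Theorems.ObservableToSLE.FloorRatio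

namespace Summit.CriticalPhenomena.SAWScalingLimit.Theorems.PolygonParitySqueeze

/-- **Registered stub `stub_arrivalMonotone` (statement `ArrivalMonotone`, unfolded): domain
monotonicity of the `σ = 0` masses.**  For `Λ ⊆ Λ'`, any mid-edges `a`, `z` and any fugacity
`x ≥ 0`, `‖F_{Λ,a,x,0}(z)‖ ≤ ‖F_{Λ',a,x,0}(z)‖`: the walks of the smaller domain inject into those of
the larger one with the same vertex list (`sum_verts_le_of_subset`), and the weights `x^{ℓ}` are
non-negative. [cite: LawlerSchrammWerner2004SAW, §3.4 ("SAW satisfies restriction")] -/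
theorem stub_arrivalMonotone :
    ∀ (Λ Λ' : Finset HexVertex), Λ ⊆ Λ' → ∀ (a z : Sym2 HexVertex) (x : ℝ), 0 ≤ x →
      ‖hexParafermionicObservable Λ a x 0 z‖ ≤ ‖hexParafermionicObservable Λ' a x 0 z‖ := by
  intro Λ Λ' h a z x hx
  rw [MassRatio.Negative.norm_Z_eq_sum Λ a z hx, MassRatio.Negative.norm_Z_eq_sum Λ' a z hx]
  exact sum_verts_le_of_subset h a z (fun l => x ^ l.length) fun _ => pow_nonneg hx _

end Summit.CriticalPhenomena.SAWScalingLimit.Theorems.PolygonParitySqueeze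

end
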